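import Literature.AnabelianGeometry.SemiGraphs.AmbientVocabConnected
import Literature.AnabelianGeometry.SemiGraphs.AmbientVocabDictionary
import Literature.AnabelianGeometry.SemiGraphs.SubdivisionTreeCount

/-!
# Trees: the container's `IsFiniteTree` at `SemiAnbdVocab.ofReal` is "finite and `SemiGraph.IsTree`" ([SemiAnbd] §1 p.13)

Mochizuki, *Semi-graphs of anabelioids*, Publ. RIMS **42** (2006), §1 p.13 ("tree": the associated
topological space is contractible) (kurims `paper:url-f33ace170ff4`). [cite: MochizukiSemiAnbd2006, §1, p. 13]

PROOF-ONLY `_iff` bridge, the last entry of the L3 merge dictionary (`AmbientVocabDictionary.lean`,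
`AmbientVocabConnected.lean`, `AmbientVocabEmbedding.lean`): the §§4–5 container renders "finite tree"
by the Euler characteristic ("finite, connected, and `#vertices = #closed edges + 1`, or no vertex at
all", `SemiAnbdVocab.IsFiniteTree`); t1 renders "tree" as "the barycentric subdivision is a tree"
(`SemiGraph.IsTree`).  At the real term the two agree for every object of `SgA`:
`SemiAnbdVocab.ofReal_isFiniteTree_iff : (ofReal R).IsFiniteTree G ↔ 𝔾.IsFinite ∧ 𝔾.IsTree`.
Route: the counting criterion `SemiGraph.isTree_iff_isConnected_and_card` (`SubdivisionTreeCount.lean`: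
tree ↔ connected ∧ `#{abutting branches} + 1 = #V + #E`) and the elementary count, for a connected
semi-graph WITH a vertex, `#{abutting branches} = #E + #{closed edges}` (no edge is isolated; the
non-abutting branches are in bijection with the non-closed edges); a connected semi-graph WITHOUT a
vertex is a single isolated edge.  No definitions.
-/

namespace Literature.AnabelianGeometry.SemiGraphs

open CategoryTheory

universe v₁ u₁ u

namespace SemiAnbdVocab

open SgAQuot SgAQuot.SgA

variable (R : SgA.BridgeResidual.{v₁, u₁, u})

section Counting

variable {G : SgA.{v₁, u₁, u}}

/-- In an equivalence generated by a relation, an element related to nothing is alone in its class.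
[folklore] -/
private theorem eqvGen_isolated {α : Type*} {r : α → α → Prop} {a : α} (ha : ∀ y, ¬ r a y)
    (ha' : ∀ y, ¬ r y a) {x y : α} (h : Relation.EqvGen r x y) : x = a ↔ y = a := by
  induction h with
  | rel x y hr =>
    constructor
    · rintro rfl; exact absurd hr (ha _)
    · rintro rfl; exact absurd hr (ha' _)
  | refl => exact Iff.rfl
  | symm _ _ _ ih => exact ih.symm
  | trans _ _ _ _ _ ih₁ ih₂ => exact ih₁.trans ih₂

/-- In a CONNECTED object an isolated edge (no branch abuts) is the only component: there is no
vertex and no other edge. [cite: MochizukiSemiAnbd2006, §1, p. 12] -/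
private theorem eq_of_isolated (hconn : (SemiAnbdVocab.ofReal R).IsConnected G)
    {e₀ : G.toSgA.graph.Edge} (he₀ : (SemiAnbdVocab.ofReal R).IsIsolatedEdge e₀)
    (x : G.toSgA.graph.Vertex ⊕ G.toSgA.graph.Edge) : x = Sum.inr e₀ := by
  have ha : ∀ y, ¬ (SemiAnbdVocab.ofReal R).Incident G (Sum.inr e₀) y := by
    rintro (v | e) h
    · obtain ⟨b, hb⟩ := h
      have := he₀ b
      change G.toSgA.graph.abuts b.1 = none at this
      change G.toSgA.graph.abuts b.1 = some v at hb
      rw [this] at hb; cases hb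
    · exact h
  have ha' : ∀ y, ¬ (SemiAnbdVocab.ofReal R).Incident G y (Sum.inr e₀) := by
    rintro (v | e) h
    · obtain ⟨b, hb⟩ := h
      have := he₀ b
      change G.toSgA.graph.abuts b.1 = none at this
      change G.toSgA.graph.abuts b.1 = some v at hb
      rw [this] at hb; cases hb
    · exact h
  exact ((eqvGen_isolated ha ha' (hconn.2 (Sum.inr e₀) x)).mp rfl)

/-- In a connected object with a vertex, no edge is isolated. [cite: MochizukiSemiAnbd2006, §1, p. 12] -/
private theorem not_isIsolatedEdge (hconn : (SemiAnbdVocab.ofReal R).IsConnected G)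
    (v : G.toSgA.graph.Vertex) (e : G.toSgA.graph.Edge) :
    ¬ (SemiAnbdVocab.ofReal R).IsIsolatedEdge e := fun he => by
  cases eq_of_isolated R hconn he (Sum.inl v)

/-- The two branches of an edge: two distinct branches of `e` exhaust its branches.
[cite: MochizukiSemiAnbd2006, §1, p. 11] -/
private theorem branchesOf_eq_or_eq {e : G.toSgA.graph.Edge} (b₁ b₂ : G.toSgA.graph.branchesOf e)
    (hne : b₁ ≠ b₂) (b : G.toSgA.graph.branchesOf e) : b = b₁ ∨ b = b₂ := by
  obtain ⟨c₁, c₂, hcne, h₁, h₂, hall⟩ := G.toSgA.graph.two_branches e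
  have k₁ := hall b₁.1 b₁.2
  have k₂ := hall b₂.1 b₂.2
  have k := hall b.1 b.2
  have hne' : b₁.1 ≠ b₂.1 := fun h => hne (Subtype.ext h)
  rcases k with k | k <;> rcases k₁ with k₁ | k₁ <;> rcases k₂ with k₂ | k₂
  · exact absurd (k₁.trans k₂.symm) hne'
  · exact Or.inl (Subtype.ext (k.trans k₁.symm))
  · exact Or.inr (Subtype.ext (k.trans k₂.symm))
  · exact absurd (k₁.trans k₂.symm) hne'
  · exact absurd (k₁.trans k₂.symm) hne'
  · exact Or.inr (Subtype.ext (k.trans k₂.symm))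
  · exact Or.inl (Subtype.ext (k.trans k₁.symm))
  · exact absurd (k₁.trans k₂.symm) hne'

/-- **In a connected object with a vertex, the non-abutting branches are in bijection with the
non-closed edges** (each open edge has exactly one non-abutting branch, no edge is isolated), hence
`#{non-abutting branches} = #{non-closed edges}`. [cite: MochizukiSemiAnbd2006, §1, p. 12] -/
private theorem natCard_notAbutting (hconn : (SemiAnbdVocab.ofReal R).IsConnected G)
    (v₀ : G.toSgA.graph.Vertex) [Finite G.toSgA.graph.Edge] :
    Nat.card {b : G.toSgA.graph.Branch // ¬ (G.toSgA.graph.abuts b).isSome} =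
      Nat.card {e : G.toSgA.graph.Edge // ¬ (SemiAnbdVocab.ofReal R).IsClosedEdge e} := by
  refine Nat.card_eq_of_bijective
    (fun b => ⟨G.toSgA.graph.edgeOf b.1, fun h => b.2 (h ⟨b.1, rfl⟩)⟩) ⟨?_, ?_⟩
  · rintro ⟨b₁, h₁⟩ ⟨b₂, h₂⟩ h
    have he : G.toSgA.graph.edgeOf b₁ = G.toSgA.graph.edgeOf b₂ := congrArg Subtype.val h
    by_contra hne
    -- two distinct non-abutting branches of one edge: that edge is isolated
    apply not_isIsolatedEdge R hconn v₀ (G.toSgA.graph.edgeOf b₂)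
    intro b
    rcases branchesOf_eq_or_eq ⟨b₁, he⟩ ⟨b₂, rfl⟩ (fun k => hne (Subtype.ext (congrArg
      (fun t : G.toSgA.graph.branchesOf _ => t.1) k))) b with rfl | rfl
    · exact Option.not_isSome_iff_eq_none.mp h₁
    · exact Option.not_isSome_iff_eq_none.mp h₂
  · rintro ⟨e, he⟩
    obtain ⟨⟨b, rfl⟩, hb⟩ := not_forall.mp he
    exact ⟨⟨b, hb⟩, rfl⟩

/-- **The count behind the Euler characteristic**: in a finite connected object WITH a vertex,
`#{abutting branches} = #edges + #{closed edges}`. [cite: MochizukiSemiAnbd2006, §1, p. 13] -/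
private theorem natCard_abutting (hconn : (SemiAnbdVocab.ofReal R).IsConnected G)
    (v₀ : G.toSgA.graph.Vertex) [Finite G.toSgA.graph.Edge] :
    Nat.card {b : G.toSgA.graph.Branch // (G.toSgA.graph.abuts b).isSome} =
      Nat.card G.toSgA.graph.Edge +
        Nat.card {e : G.toSgA.graph.Edge // (SemiAnbdVocab.ofReal R).IsClosedEdge e} := by
  classical
  haveI := G.toSgA.graph.finite_branch
  have hB := G.toSgA.graph.natCard_branch
  have hsplitB : Nat.card G.toSgA.graph.Branch =
      Nat.card {b : G.toSgA.graph.Branch // (G.toSgA.graph.abuts b).isSome} +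
        Nat.card {b : G.toSgA.graph.Branch // ¬ (G.toSgA.graph.abuts b).isSome} := by
    rw [← Nat.card_sum]
    exact Nat.card_congr (Equiv.sumCompl fun b : G.toSgA.graph.Branch =>
      ((G.toSgA.graph.abuts b).isSome : Prop)).symm
  have hsplitE : Nat.card G.toSgA.graph.Edge =
      Nat.card {e : G.toSgA.graph.Edge // (SemiAnbdVocab.ofReal R).IsClosedEdge e} +
        Nat.card {e : G.toSgA.graph.Edge // ¬ (SemiAnbdVocab.ofReal R).IsClosedEdge e} := by
    rw [← Nat.card_sum]
    exact Nat.card_congr (Equiv.sumCompl fun e : G.toSgA.graph.Edge =>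
      (SemiAnbdVocab.ofReal R).IsClosedEdge e).symm
  have hna := natCard_notAbutting R hconn v₀
  omega

end Counting

/-- **The container's "finite tree" at the real vocabulary is "finite and t1's `SemiGraph.IsTree`"**
(the barycentric subdivision is a tree). [cite: MochizukiSemiAnbd2006, §1, p. 13] -/
theorem ofReal_isFiniteTree_iff (G : SgA.{v₁, u₁, u}) :
    (SemiAnbdVocab.ofReal R).IsFiniteTree G ↔ G.toSgA.graph.IsFinite ∧ G.toSgA.graph.IsTree := by
  change (SemiAnbdVocab.ofReal R).IsFinite G ∧ (SemiAnbdVocab.ofReal R).IsConnected G ∧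
      (Nat.card G.toSgA.graph.Vertex =
          Nat.card {e : G.toSgA.graph.Edge // (SemiAnbdVocab.ofReal R).IsClosedEdge e} + 1 ∨
        IsEmpty G.toSgA.graph.Vertex) ↔ _
  rw [ofReal_isFinite_iff]
  constructor
  · rintro ⟨hfin, hconn, h⟩
    haveI := hfin.finite_vertex
    haveI := hfin.finite_edge
    refine ⟨hfin, (G.toSgA.graph.isTree_iff_isConnected_and_card hfin).mpr
      ⟨(ofReal_isConnected_iff R G).mp hconn, ?_⟩⟩
    rcases isEmpty_or_nonempty G.toSgA.graph.Vertex with hV | ⟨⟨v₀⟩⟩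
    · -- no vertex: a single isolated edge
      have hA : Nat.card {b : G.toSgA.graph.Branch // (G.toSgA.graph.abuts b).isSome} = 0 := by
        rw [Nat.card_eq_zero]
        refine Or.inl ⟨fun ⟨b, hb⟩ => ?_⟩
        obtain ⟨v, _⟩ := Option.isSome_iff_exists.mp hb
        exact hV.false v
      obtain ⟨x₀⟩ := hconn.1
      rcases x₀ with v | e₀
      · exact hV.elim v
      · have hiso : (SemiAnbdVocab.ofReal R).IsIsolatedEdge e₀ := fun b => by
          change G.toSgA.graph.abuts b.1 = none
          cases hb : G.toSgA.graph.abuts b.1 with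
          | none => rfl
          | some v => exact hV.elim v
        have hE : Nat.card G.toSgA.graph.Edge = 1 := by
          rw [Nat.card_eq_one_iff_exists]
          refine ⟨e₀, fun e => ?_⟩
          have := eq_of_isolated R hconn hiso (Sum.inr e)
          simpa using this
        rw [hA, hE, Nat.card_eq_zero.mpr (Or.inl hV)]
    · have h' : Nat.card G.toSgA.graph.Vertex =
          Nat.card {e : G.toSgA.graph.Edge // (SemiAnbdVocab.ofReal R).IsClosedEdge e} + 1 := by
        rcases h with h | h
        · exact h
        · exact h.elim v₀
      rw [natCard_abutting R hconn v₀]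
      omega
  · rintro ⟨hfin, htree⟩
    haveI := hfin.finite_vertex
    haveI := hfin.finite_edge
    obtain ⟨hconn', hcount⟩ := (G.toSgA.graph.isTree_iff_isConnected_and_card hfin).mp htree
    have hconn := (ofReal_isConnected_iff R G).mpr hconn'
    refine ⟨hfin, hconn, ?_⟩
    rcases isEmpty_or_nonempty G.toSgA.graph.Vertex with hV | ⟨⟨v₀⟩⟩
    · exact Or.inr hV
    · left
      rw [natCard_abutting R hconn v₀] at hcount
      omega

end SemiAnbdVocab

end Literature.AnabelianGeometry.SemiGraphs
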